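import Summits.QuantumFields.YangMills.Theorems.FluctuationComparisonRegPrIntLS2BetaParityDescent
import HarnessLib

/-!
# S2β · D-GUARD ∕ (BG∞) — PARITY DESCENT, EXISTENCE AND MEMBERSHIP ((L-D) continued, UV3-NODE §116 ADD.1; binder style): from every closed block containing `v` there IS a
# descent (the relational descent of ✓p839801 is total on members), the descended block again contains `v`, it is EVEN-or-interior along the axis (no further descent),
# and its parity does not go up — the three facts (L-Σ) needs to DEFINE `ψ_Q(y) := G_{D(Q,y)}(y)` by choice and to run (DESC) ∘ (D2)

Cell `ym3-torus` (YM ladder rung R3 = continuum `SU(2)` Yang–Mills on the three-torus at fixed lattice data — a RUNG: NOT d = 4, NOT infinite volume,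
NOT a mass gap, NOT Clay).  Width seat «width 19» `ym3-torus-px19` (gen 25, ★p1 lineage), FREE px helper on crux `stmt-QuantumFields-20520`
(`FluctuationComparisonRegPrIntL`; registry `Lines/semiclassical_s2beta.lean` UNTOUCHED, 0∕5); `--kind proof --supports stmt-QuantumFields-20520 --as helper`,
count-neutral, DEFINITION-FREE (0 `def`, 0 `instance`, 0 `notation`, 0 `sorry`, default heartbeats).

WHAT IS PROVED (sorry-free; one axis; binders `len start : Fin M → ℕ` + the three start laws + `1 ≤ len`, `3 ≤ M`; «`Succ i j`» and the three-way descent relation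
`IsDesc i v j` written out exactly as in ✓p839801 `descent_agrees`).
* ★★ `exists_descent` — `∃ j, IsDesc i v j` for every block `i` and residue `v` (an odd block has a predecessor since `i ≥ 1`; every block has a cyclic successor).
* ★★ `memClosed_of_descent` — `IsDesc i v j ⟹ v` lies in the closed block `j` (bottom of `i` = top of `pred i`; top of `i` = bottom of `succ i`, wrap included).
* ★ `descent_stable` — `IsDesc i v j ⟹ IsDesc j v j` (the descended block does not descend further at `v`: it is even, or `v` is interior to it).
* ★ `descent_parity_le` — `IsDesc i v j ⟹ (j:ℕ) % 2 ≤ (i:ℕ) % 2` (parity never goes up; with `Even M`, an odd block descends onto an EVEN one when it moves).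

HONEST SCOPE.  `Fin`∕`ZMod`∕parity bookkeeping continuing ✓p839801; nothing of Bałaban's renormalisation-group analysis is asserted or proved ([Balaban1985RegularSpaces] Lemma 1
p.79).  (BG∞) ∕ `hsupp⁺` ∕ `hSec` are NOT proved; GAP♯∘ (`stub_uniformFibreGapOrbit`, registry UNTOUCHED), the five registered stubs (0∕5), S2β, 20520, 19936, 19200,
`YM3TorusSU2` are NOT proved; no registered stub is closed; rung R3 — NOT d = 4, NOT infinite volume, NOT a mass gap, NOT Clay; the Yang–Mills mass gap is NOT proved.

References: T. Bałaban, CMP **99** (1985) 75–102 [Balaban1985RegularSpaces] (Lemma 1 p.79, (1.29) p.81).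
-/

set_option autoImplicit false

namespace Summit.QuantumFields.YangMills.Theorems.FluctuationComparisonRegPrIntLS2BetaParityDescentExists

open Summit.QuantumFields.YangMills.Theorems.FluctuationComparisonRegPrIntLS2BetaParityDescent
  (memClosed_iff start_add_len_le start_add_len_lt start_pos val_sub_natCast_of_le val_sub_natCast_of_lt odd_iff_succ_even)

variable {M N : ℕ} (len start : Fin M → ℕ)

/-- ★★ **A DESCENT EXISTS** from every block (an odd block has a predecessor since `i ≥ 1`; every block has a cyclic successor). [folklore] -/
theorem exists_descent (i : Fin M) (v : ZMod N) :
    ∃ j : Fin M,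
      ((i : ℕ) % 2 = 1 ∧ (v - ((start i : ℕ) : ZMod N)).val = 0 ∧ ((i : ℕ) = (j : ℕ) + 1 ∨ ((j : ℕ) + 1 = M ∧ (i : ℕ) = 0))) ∨
      ((i : ℕ) % 2 = 1 ∧ (v - ((start i : ℕ) : ZMod N)).val = len i ∧ ((j : ℕ) = (i : ℕ) + 1 ∨ ((i : ℕ) + 1 = M ∧ (j : ℕ) = 0))) ∨
      (¬ ((i : ℕ) % 2 = 1 ∧ ((v - ((start i : ℕ) : ZMod N)).val = 0 ∨ (v - ((start i : ℕ) : ZMod N)).val = len i)) ∧ j = i) := by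
  have hiM := i.isLt
  by_cases ho : (i : ℕ) % 2 = 1
  · by_cases h0 : (v - ((start i : ℕ) : ZMod N)).val = 0
    · -- odd, at the bottom: the predecessor (`i ≥ 1`)
      refine ⟨⟨(i : ℕ) - 1, by omega⟩, Or.inl ⟨ho, h0, Or.inl ?_⟩⟩
      show (i : ℕ) = ((i : ℕ) - 1) + 1
      omega
    · by_cases hL : (v - ((start i : ℕ) : ZMod N)).val = len i
      · -- odd, at the top: the cyclic successor
        by_cases hlast : (i : ℕ) + 1 = M
        · exact ⟨⟨0, by omega⟩, Or.inr (Or.inl ⟨ho, hL, Or.inr ⟨hlast, rfl⟩⟩)⟩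
        · exact ⟨⟨(i : ℕ) + 1, by omega⟩, Or.inr (Or.inl ⟨ho, hL, Or.inl rfl⟩)⟩
      · exact ⟨i, Or.inr (Or.inr ⟨fun h => h.2.elim h0 hL, rfl⟩)⟩
  · exact ⟨i, Or.inr (Or.inr ⟨fun h => ho h.1, rfl⟩)⟩

/-- ★★ **THE DESCENDED BLOCK CONTAINS THE RESIDUE** (bottom of `i` = top of its predecessor; top of `i` = bottom of its successor, wrap included). [folklore] -/
theorem memClosed_of_descent [NeZero N] (hlen : ∀ i, 1 ≤ len i) (hz : ∀ i : Fin M, (i : ℕ) = 0 → start i = 0)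
    (hs : ∀ i j : Fin M, (j : ℕ) = (i : ℕ) + 1 → start j = start i + len i) (hl : ∀ i : Fin M, (i : ℕ) + 1 = M → start i + len i = N)
    (i j : Fin M) (v : ZMod N) (hi : (v - ((start i : ℕ) : ZMod N)).val ≤ len i)
    (hj : ((i : ℕ) % 2 = 1 ∧ (v - ((start i : ℕ) : ZMod N)).val = 0 ∧ ((i : ℕ) = (j : ℕ) + 1 ∨ ((j : ℕ) + 1 = M ∧ (i : ℕ) = 0))) ∨
      ((i : ℕ) % 2 = 1 ∧ (v - ((start i : ℕ) : ZMod N)).val = len i ∧ ((j : ℕ) = (i : ℕ) + 1 ∨ ((i : ℕ) + 1 = M ∧ (j : ℕ) = 0))) ∨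
      (¬ ((i : ℕ) % 2 = 1 ∧ ((v - ((start i : ℕ) : ZMod N)).val = 0 ∨ (v - ((start i : ℕ) : ZMod N)).val = len i)) ∧ j = i)) :
    (v - ((start j : ℕ) : ZMod N)).val ≤ len j := by
  have hvN : v.val < N := ZMod.val_lt v
  have hle := start_add_len_le len start hs hl i
  have hlej := start_add_len_le len start hs hl j
  have hsN : start i < N := by have := hlen i; omega
  have hmem := (memClosed_iff len start hlen hs hl i v).1 hi
  rw [memClosed_iff len start hlen hs hl j v]
  rcases hj with ⟨ho, h0, hp⟩ | ⟨ho, hL, hsu⟩ | ⟨_, hji⟩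
  · -- bottom of `i` = top of `pred i`; `i` odd so `i ≥ 1`, no wrap in `hp`
    rcases hp with hp | ⟨_, hi0⟩
    · have hss : start i = start j + len j := hs j i hp
      rcases hmem with ⟨h1, h2⟩ | ⟨hiM, hv⟩
      · have hv : v.val = start i := by rw [val_sub_natCast_of_le v h1] at h0; omega
        left; omega
      · -- `i` last and `v = 0`: then `(v − start i).val = N − start i = len i ≠ 0`
        exfalso
        have hsp : 0 < start i := start_pos len start hs hlen i (by omega)
        rw [val_sub_natCast_of_lt v hsN (by rw [hv]; exact hsp), hv] at h0
        have := hlen i; omega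
    · omega
  · -- top of `i` = bottom of `succ i`
    rcases hsu with hsu | ⟨hiM, hj0⟩
    · have hss : start j = start i + len i := hs i j hsu
      rcases hmem with ⟨h1, h2⟩ | ⟨hiM, hv⟩
      · have hv : v.val = start i + len i := by rw [val_sub_natCast_of_le v h1] at hL; omega
        left; have := hlen j; omega
      · omega
    · -- wrap: `i` last, `j = 0`, and `v = 0`
      have hs0 : start j = 0 := hz j hj0
      rcases hmem with ⟨h1, h2⟩ | ⟨_, hv⟩
      · -- `(v − start i).val = v.val − start i = len i` with `start i + len i = N > v.val`: impossible
        exfalso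
        rw [val_sub_natCast_of_le v h1] at hL
        have := hl i hiM; omega
      · left
        rw [hs0, hv]
        exact ⟨le_rfl, Nat.zero_le _⟩
  · rw [hji]; exact hmem

/-- ★ **THE DESCENT IS STABLE**: the descended block does not descend further at `v` (it is even when it moved; otherwise it is `i` itself, which did not move).
[folklore] -/
theorem descent_stable (hEven : Even M) (i j : Fin M) (v : ZMod N)
    (hj : ((i : ℕ) % 2 = 1 ∧ (v - ((start i : ℕ) : ZMod N)).val = 0 ∧ ((i : ℕ) = (j : ℕ) + 1 ∨ ((j : ℕ) + 1 = M ∧ (i : ℕ) = 0))) ∨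
      ((i : ℕ) % 2 = 1 ∧ (v - ((start i : ℕ) : ZMod N)).val = len i ∧ ((j : ℕ) = (i : ℕ) + 1 ∨ ((i : ℕ) + 1 = M ∧ (j : ℕ) = 0))) ∨
      (¬ ((i : ℕ) % 2 = 1 ∧ ((v - ((start i : ℕ) : ZMod N)).val = 0 ∨ (v - ((start i : ℕ) : ZMod N)).val = len i)) ∧ j = i)) :
    ¬ ((j : ℕ) % 2 = 1 ∧ ((v - ((start j : ℕ) : ZMod N)).val = 0 ∨ (v - ((start j : ℕ) : ZMod N)).val = len j)) := by
  rcases hj with ⟨ho, _, hp⟩ | ⟨ho, _, hsu⟩ | ⟨hno, hji⟩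
  · -- `j = pred i` is even
    have hpar := odd_iff_succ_even hEven j i hp
    intro h; omega
  · have hpar := odd_iff_succ_even hEven i j hsu
    intro h; omega
  · rw [hji]; exact hno

/-- ★ **PARITY NEVER GOES UP** along a descent (`Even M`). [folklore] -/
theorem descent_parity_le (hEven : Even M) (i j : Fin M) (v : ZMod N)
    (hj : ((i : ℕ) % 2 = 1 ∧ (v - ((start i : ℕ) : ZMod N)).val = 0 ∧ ((i : ℕ) = (j : ℕ) + 1 ∨ ((j : ℕ) + 1 = M ∧ (i : ℕ) = 0))) ∨
      ((i : ℕ) % 2 = 1 ∧ (v - ((start i : ℕ) : ZMod N)).val = len i ∧ ((j : ℕ) = (i : ℕ) + 1 ∨ ((i : ℕ) + 1 = M ∧ (j : ℕ) = 0))) ∨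
      (¬ ((i : ℕ) % 2 = 1 ∧ ((v - ((start i : ℕ) : ZMod N)).val = 0 ∨ (v - ((start i : ℕ) : ZMod N)).val = len i)) ∧ j = i)) :
    (j : ℕ) % 2 ≤ (i : ℕ) % 2 := by
  rcases hj with ⟨ho, _, hp⟩ | ⟨ho, _, hsu⟩ | ⟨_, hji⟩
  · have hpar := odd_iff_succ_even hEven j i hp; omega
  · have hpar := odd_iff_succ_even hEven i j hsu; omega
  · rw [hji]

end Summit.QuantumFields.YangMills.Theorems.FluctuationComparisonRegPrIntLS2BetaParityDescentExists
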